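import Literature.Computability.QuantumComplexity.AaronsonAmbainisThm23Formulas
import HarnessLib

/-!
# Aaronson–Ambainis 2014, Thm. 23 (machine half): the meaning of the counting formulas on coded inputs, I — atoms

Third machine-level file of the polynomial-time half of Thm. 23 (arXiv:0911.0996v3, p. 14). The
formulas of `AaronsonAmbainisThm23Formulas.lean` are total (they read any word); here we fix the
CODING of the mathematical data and compute every atom on coded inputs:

* `encRho ρ` (the restriction list `ρ : List (Fin M × Bool)` as a coded list of items
  `⟨bin j, b⟩`), `encW F x ρ i = ⟨x, ⟨descFn x, ⟨encRho ρ, bin i⟩⟩⟩`, `recV` (the record with four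
  coin numerals), `digits μ v` (the coin function of the numeral `v`);
* the `ρ`-atoms on `encRho ρ`: `rLive_encRho_iff` (`m < |ρ|`), `rIdx_encRho`, `rBit_encRho_iff`;
  `first_encRho_iff`, `free_encRho_iff` (in terms of `OracleReads.firstVal`);
* the path atoms on `(x, bin v, t)`: `pLive_iff`, `pRead_iff`, `pHad_iff`, `pVal_iff`, `pIdx_eq`
  (the canonical number of the query, i.e. the oracle-bit index of the read), `pVld_iff`,
  `labF_eq`, `pAcc_iff`, `phkF_eq` — all through the coin function `digits μ v`
  (`tRunO_encodeNat`, `labAt_encodeNat`);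
* the counts: `nGates_eq` (`μ`), `nHad_eq` (`hCount`), `nOrc_eq` (number of oracle gates);
  `guard_iff`;
* the sign conditions: `tPos_iff`/`tNeg_iff` — `TPos`/`TNeg` hold iff the pair term `tA`/`tB`
  of `AaronsonAmbainisMoments.lean` is `+1`/`−1` — and `tSign_iff`.

No named facts.

## References

* S. Aaronson, A. Ambainis, *The need for structure in quantum speedups*, Theory Comput. 10
  (2014), proof of Thm. 23 (arXiv:0911.0996v3, p. 14) [AaronsonAmbainis2014].
* L. M. Adleman, J. DeMarrais, M.-D. A. Huang, *Quantum computability*, SIAM J. Comput. 26 (1997),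
  §6, Lemma 6.10 (phase classes of path pairs) [AdlemanDeMarraisHuang1997].
-/

noncomputable section

namespace Literature.Computability.QuantumComplexity

namespace Thm23Machine

open _root_.Computability Polynomial Complexity Complexity.Brick Complexity.Plumb Cryptography ADH Finset OracleReads
open Complexity.PRelSigma Complexity.TTClosure Complexity.PPSharpP Complexity.ThresholdPP
open scoped Classical

attribute [-simp] Brick.nthF_zero Brick.sndPow_zero

/-! ### The coding -/

section Coding

variable (F : QCircuitFamily cliffordT) (x : List Bool)

/-- The coded restriction list: items `⟨bin j, b⟩`. [folklore] -/
def encRho {M : ℕ} (ρ : List (Fin M × Bool)) : List Bool :=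
  encList (ρ.map fun e => boolPair (encodeNat (e.1 : ℕ)) [e.2])

/-- **The coded node**: `⟨x, ⟨d, ⟨ρ̂, bin i⟩⟩⟩`. [folklore] -/
def encW (ρ : List (Fin (numOracleBits F x) × Bool)) (i : Fin (numOracleBits F x)) : List Bool :=
  boolPair x (boolPair (F.descFn x) (boolPair (encRho ρ) (encodeNat (i : ℕ))))

/-- The record of a coded node and four coin numerals. [folklore] -/
def recV (ρ : List (Fin (numOracleBits F x) × Bool)) (i : Fin (numOracleBits F x)) (v₀ v₁ v₂ v₃ : ℕ) : List Bool :=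
  mkR (encW F x ρ i) (encodeNat v₀) (encodeNat v₁) (encodeNat v₂) (encodeNat v₃)

/-- The coin function of a numeral: its binary digits. [folklore] -/
def digits (μ v : ℕ) : Fin μ → Bool := fun t => v.testBit t

/-- Reading the record. [folklore] -/
theorem access_recV (ρ : List (Fin (numOracleBits F x) × Bool)) (i : Fin (numOracleBits F x)) (v₀ v₁ v₂ v₃ : ℕ) :
    xR (recV F x ρ i v₀ v₁ v₂ v₃) = x ∧ dR (recV F x ρ i v₀ v₁ v₂ v₃) = F.descFn x ∧
    rhoR (recV F x ρ i v₀ v₁ v₂ v₃) = encRho ρ ∧ iR (recV F x ρ i v₀ v₁ v₂ v₃) = encodeNat i ∧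
    coinR 0 (recV F x ρ i v₀ v₁ v₂ v₃) = encodeNat v₀ ∧ coinR 1 (recV F x ρ i v₀ v₁ v₂ v₃) = encodeNat v₁ ∧
    coinR 2 (recV F x ρ i v₀ v₁ v₂ v₃) = encodeNat v₂ ∧ coinR 3 (recV F x ρ i v₀ v₁ v₂ v₃) = encodeNat v₃ := by
  obtain ⟨-, h⟩ := access_mkR x (F.descFn x) (encRho ρ) (encodeNat i) (encodeNat v₀) (encodeNat v₁) (encodeNat v₂) (encodeNat v₃)
  exact h

end Coding

/-! ### The `ρ`-atoms on a coded list -/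

section RhoSem

variable {M : ℕ} (ρ : List (Fin M × Bool))

/-- The coded list is at least as long as the list. [folklore] -/
theorem length_le_length_encRho : ρ.length ≤ (encRho ρ).length := by
  have := two_mul_length_le_length_encList (ρ.map fun e => boolPair (encodeNat (e.1 : ℕ)) [e.2])
  rw [List.length_map] at this; unfold encRho; omega

/-- `dropLF` on the coded list with itself as yardstick. [folklore] -/
theorem dropLF_encRho (m : ℕ) :
    dropLF (boolPair (encRho ρ) (boolPair (encodeNat m) (encRho ρ))) =
      encList (((ρ.map fun e => boolPair (encodeNat (e.1 : ℕ)) [e.2])).drop (min m (encRho ρ).length)) := by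
  rw [dropLF_record, activeRounds_encodeNat, encRho, sndF_iterate_encList]

/-- `RLive` on the coded list: the dropped coded list is nonempty. [folklore] -/
theorem rLive_encRho_iff_ne_nil (m : ℕ) :
    RLive (encRho ρ) m ↔ encList (((ρ.map fun e => boolPair (encodeNat (e.1 : ℕ)) [e.2])).drop (min m (encRho ρ).length)) ≠ [] := by
  unfold RLive liveRF
  rw [notFn_apply (nilT_apply _ _)]
  rw [show (dropLF ∘ pairFn fstP (pairFn sndP fstP)) (boolPair (encRho ρ) (encodeNat m)) =
      dropLF (boolPair (encRho ρ) (boolPair (encodeNat m) (encRho ρ))) by simp [pairFn_apply], dropLF_encRho]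
  cases h : decide (encList (((ρ.map fun e => boolPair (encodeNat (e.1 : ℕ)) [e.2])).drop (min m (encRho ρ).length)) = [])
  · simp only [decide_eq_false_iff_not] at h; simp [h]
  · simp only [decide_eq_true_eq] at h; simp [h]

/-- **`RLive (encRho ρ) m ↔ m < |ρ|`.** [folklore] -/
theorem rLive_encRho_iff (m : ℕ) : RLive (encRho ρ) m ↔ m < ρ.length := by
  rw [rLive_encRho_iff_ne_nil]
  have hlen := length_le_length_encRho ρ
  constructor
  · intro h
    by_contra hm
    apply h
    rw [List.drop_eq_nil_of_le (by rw [List.length_map]; exact le_min (not_lt.1 hm) hlen), encList_nil]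
  · intro hm h
    rw [min_eq_left (hm.le.trans hlen)] at h
    have hne : ((ρ.map fun e => boolPair (encodeNat (e.1 : ℕ)) [e.2]).drop m) ≠ [] := by
      intro h0
      rw [List.drop_eq_nil_iff, List.length_map] at h0
      omega
    obtain ⟨a, l, hal⟩ := List.exists_cons_of_ne_nil hne
    rw [hal, encList_cons] at h
    exact absurd h (by simp [boolPair])

/-- Item `m` of the coded list. [folklore] -/
theorem itemRF_encRho {m : ℕ} (hm : m < ρ.length) :
    itemRF (boolPair (encRho ρ) (encodeNat m)) = boolPair (encodeNat (ρ[m].1 : ℕ)) [ρ[m].2] := by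
  unfold itemRF
  simp only [Function.comp_apply, pairFn_apply, fstP_boolPair, sndP_boolPair]
  have hk : m ≤ (encRho ρ).length := hm.le.trans (length_le_length_encRho ρ)
  change nthLF (boolPair (encRho ρ) (boolPair (encodeNat m) (encList (ρ.map fun e => boolPair (encodeNat (e.1 : ℕ)) [e.2])))) = _
  rw [nthLF_apply _ hk, List.getD_eq_getElem _ _ (by simpa using hm)]
  simp

/-- **`RIdx (encRho ρ) m = ρ[m].1`.** [folklore] -/
theorem rIdx_encRho {m : ℕ} (hm : m < ρ.length) : RIdx (encRho ρ) m = (ρ[m].1 : ℕ) := by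
  unfold RIdx ridxRF; rw [Function.comp_apply, itemRF_encRho ρ hm, fstF_boolPair, bitsToNat_encodeNat]

/-- **`RBit (encRho ρ) m ↔ ρ[m].2 = 1`.** [folklore] -/
theorem rBit_encRho_iff {m : ℕ} (hm : m < ρ.length) : RBit (encRho ρ) m ↔ ρ[m].2 = true := by
  unfold RBit rbitRF; rw [bitT_apply, Function.comp_apply, itemRF_encRho ρ hm, sndF_boolPair]; simp

/-- **`firstVal` by position**: if `m` is the position of the first entry at `j` then `firstVal ρ j`
is its bit. [folklore] -/
theorem firstVal_eq_of_first : ∀ (ρ : List (Fin M × Bool)) (j : Fin M) (m : ℕ) (hm : m < ρ.length),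
    ρ[m].1 = j → (∀ m' < m, ∀ hm' : m' < ρ.length, ρ[m'].1 ≠ j) → firstVal ρ j = some ρ[m].2
  | [], j, m, hm, _, _ => by simp at hm
  | (k, b) :: ρ, j, 0, hm, hj, _ => by simp only [List.getElem_cons_zero] at hj ⊢; rw [firstVal_cons, if_pos hj]
  | (k, b) :: ρ, j, m + 1, hm, hj, hall => by
    have hk : k ≠ j := by have := hall 0 (Nat.zero_lt_succ _) (by simp); simpa using this
    rw [firstVal_cons, if_neg hk]
    simp only [List.getElem_cons_succ] at hj ⊢
    exact firstVal_eq_of_first ρ j m (by simpa using hm) hj fun m' h1 h2 => by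
      have := hall (m' + 1) (by omega) (by simpa using h2)
      simpa using this

/-- `firstVal = none` by position. [folklore] -/
theorem firstVal_eq_none_iff' (j : Fin M) : firstVal ρ j = none ↔ ∀ m, ∀ hm : m < ρ.length, ρ[m].1 ≠ j := by
  rw [firstVal_eq_none_iff]
  constructor
  · intro h m hm; exact h _ (List.getElem_mem hm)
  · intro h e he; obtain ⟨m, hm, rfl⟩ := List.getElem_of_mem he; exact h m hm

/-- If some entry is at `j`, there is a first one. [folklore] -/
theorem exists_first_of_mem {j : Fin M} (h : ∃ m, ∃ hm : m < ρ.length, ρ[m].1 = j) :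
    ∃ m, ∃ hm : m < ρ.length, ρ[m].1 = j ∧ ∀ m' < m, ∀ hm' : m' < ρ.length, ρ[m'].1 ≠ j := by
  classical
  let P : ℕ → Prop := fun m => ∃ hm : m < ρ.length, ρ[m].1 = j
  have hP : ∃ m, P m := by obtain ⟨m, hm, h⟩ := h; exact ⟨m, hm, h⟩
  refine ⟨Nat.find hP, (Nat.find_spec hP).1, (Nat.find_spec hP).2, fun m' hm' hm'' heq => ?_⟩
  exact Nat.find_min hP hm' ⟨hm'', heq⟩

/-- **`First (encRho ρ) j m`** iff `m` is the position of the first entry at `j`. [folklore] -/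
theorem first_encRho_iff (j m : ℕ) :
    First (encRho ρ) j m ↔ ∃ hm : m < ρ.length, (ρ[m].1 : ℕ) = j ∧ ∀ m' < m, ∀ hm' : m' < ρ.length, (ρ[m'].1 : ℕ) ≠ j := by
  unfold First
  rw [rLive_encRho_iff]
  constructor
  · rintro ⟨hm, hj, hall⟩
    rw [rIdx_encRho ρ hm] at hj
    exact ⟨hm, hj, fun m' hm' hm'' => by rw [← rIdx_encRho ρ hm'']; exact hall m' hm'⟩
  · rintro ⟨hm, hj, hall⟩
    refine ⟨hm, by rw [rIdx_encRho ρ hm, hj], fun m' hm' => ?_⟩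
    rw [rIdx_encRho ρ (hm'.trans hm)]; exact hall m' hm' _

/-- **`Free (encRho ρ) j`** iff no entry of `ρ` is at `j`. [folklore] -/
theorem free_encRho_iff (j : ℕ) : Free (encRho ρ) j ↔ ∀ m, ∀ hm : m < ρ.length, (ρ[m].1 : ℕ) ≠ j := by
  unfold Free
  constructor
  · intro h m hm; rw [← rIdx_encRho ρ hm]; exact h m (hm.trans_le (length_le_length_encRho ρ)) ((rLive_encRho_iff ρ m).2 hm)
  · intro h m _ hl; rw [rLive_encRho_iff] at hl; rw [rIdx_encRho ρ hl]; exact h m hl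

/-- `First` at the index of a variable pins `firstVal`. [folklore] -/
theorem firstVal_of_first_encRho {j : Fin M} {m : ℕ} (h : First (encRho ρ) j m) :
    ∃ hm : m < ρ.length, ρ[m].1 = j ∧ firstVal ρ j = some ρ[m].2 := by
  obtain ⟨hm, hj, hall⟩ := (first_encRho_iff ρ j m).1 h
  have hj' : ρ[m].1 = j := Fin.ext hj
  exact ⟨hm, hj', firstVal_eq_of_first ρ j m hm hj' fun m' h1 h2 h3 => hall m' h1 h2 (by rw [h3])⟩

/-- Conversely, a `some` value of `firstVal` is witnessed by a `First` position. [folklore] -/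
theorem exists_first_encRho_of_firstVal {j : Fin M} {b : Bool} (h : firstVal ρ j = some b) :
    ∃ m, ∃ hm : m < ρ.length, First (encRho ρ) j m ∧ ρ[m].2 = b := by
  have hex : ∃ m, ∃ hm : m < ρ.length, ρ[m].1 = j := by
    by_contra hne
    push Not at hne
    rw [(firstVal_eq_none_iff' ρ j).2 hne] at h
    exact absurd h (by simp)
  obtain ⟨m, hm, hj, hall⟩ := exists_first_of_mem ρ hex
  have hv := firstVal_eq_of_first ρ j m hm hj hall
  rw [h, Option.some.injEq] at hv
  exact ⟨m, hm, (first_encRho_iff ρ j m).2 ⟨hm, by rw [hj], fun m' h1 h2 h3 => hall m' h1 h2 (Fin.ext h3)⟩, hv.symm⟩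

/-- `Free` versus `firstVal`. [folklore] -/
theorem free_encRho_fin_iff (j : Fin M) : Free (encRho ρ) j ↔ firstVal ρ j = none := by
  rw [free_encRho_iff, firstVal_eq_none_iff']
  exact ⟨fun h m hm heq => h m hm (by rw [heq]), fun h m hm heq => h m hm (Fin.ext heq)⟩

end RhoSem

/-! ### The path atoms on coded coins -/

section PathSem

variable (F : QCircuitFamily cliffordT) (x : List Bool)

/-- The gate list at `x`. [folklore] -/
abbrev gts : List (QGate cliffordT (x.length + F.ancillas x.length)) := (F.circ x.length).gates

/-- **The walk on a numeral is the walk on its digits.** [folklore] -/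
theorem tRunO_encodeNat (gs : List (QGate cliffordT (x.length + F.ancillas x.length))) (hgs : gs.length ≤ (gts F x).length)
    (v : ℕ) (s : TState (x.length + F.ancillas x.length)) :
    tRunO gs (encodeNat v) s = tRunO gs (List.ofFn (digits (gts F x).length v)) s :=
  tRunO_congr gs _ _ s fun t ht => by rw [getD_encodeNat_eq, getD_ofFn _ t (ht.trans_le hgs)]; rfl

/-- The final state of a numeral is `st` of its digits. [folklore] -/
theorem stO_encodeNat (v : ℕ) : stO F x (encodeNat v) = st F x (digits (gts F x).length v) :=
  tRunO_encodeNat F x _ le_rfl v _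

/-- The label before round `t` of a numeral. [folklore] -/
theorem labAt_encodeNat (v t : ℕ) :
    labAt F x (encodeNat v) t = labAt F x (List.ofFn (digits (gts F x).length v)) t := by
  unfold labAt; rw [tRunO_encodeNat F x _ (by rw [List.length_take]; exact min_le_right _ _) v]

/-- **`PLive x c t ↔ t < μ`.** [folklore] -/
theorem pLive_iff (c : List Bool) (t : ℕ) : PLive F x c t ↔ t < (gts F x).length := by
  unfold PLive; rw [liveT_apply]; simp

/-- **`PRead x c t`** iff gate `t` is an oracle gate. [folklore] -/
theorem pRead_iff (c : List Bool) (t : ℕ) : PRead F x c t ↔ ∃ (ht : t < (gts F x).length) (k : ℕ) (e : _), (gts F x)[t] = .oracle k e := by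
  unfold PRead; rw [orcT_apply]
  simp only [List.cons.injEq, and_true]
  by_cases ht : t < (gts F x).length
  · rw [List.getElem?_eq_getElem ht]
    simp only [Option.map_some, Option.getD_some, ht, exists_true_left]
    cases (gts F x)[t] with
    | gate op e => simp [isOracleB]
    | oracle k e => simp only [isOracleB, true_iff]; exact ⟨k, e, rfl⟩
  · rw [List.getElem?_eq_none (not_lt.1 ht)]; simp [ht]

/-- **`PHad x c t`** iff gate `t` is a Hadamard gate. [folklore] -/
theorem pHad_iff (c : List Bool) (t : ℕ) : PHad F x c t ↔ ∃ ht : t < (gts F x).length, QGateIsH (gts F x)[t] = true := by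
  unfold PHad; rw [hadT_apply]
  simp only [List.cons.injEq, and_true]
  by_cases ht : t < (gts F x).length
  · rw [List.getElem?_eq_getElem ht]; simp [ht]
  · rw [List.getElem?_eq_none (not_lt.1 ht)]; simp [ht]

/-- **`PVal x (bin v) t ↔` digit `t` of `v` is `1`** (`t < μ`). [folklore] -/
theorem pVal_iff (v : ℕ) {t : ℕ} (ht : t < (gts F x).length) : PVal F x (encodeNat v) t ↔ digits (gts F x).length v ⟨t, ht⟩ = true := by
  unfold PVal; rw [coinT_apply F x _ ht, getD_encodeNat_eq]; simp [digits]

/-- **`PIdx x (bin v) t` at an oracle gate is the oracle-bit index of the read.** [cite: AaronsonAmbainis2014, proof of Thm. 23 (p. 14)] -/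
theorem pIdx_eq (v : ℕ) {t : ℕ} (ht : t < (gts F x).length) {k : ℕ} {e : Fin (k + 1) ↪ Fin (x.length + F.ancillas x.length)}
    (hg : (gts F x)[t] = .oracle k e) :
    PIdx F x (encodeNat v) t =
      (bitEquiv F x ⟨queryOf e (labAt F x (List.ofFn (digits (gts F x).length v)) t), mem_shortStrings.2 (length_queryOf_lt e _)⟩ : ℕ) := by
  unfold PIdx; rw [idxF_apply F x _ ht hg, bitsToNat_encodeNat, bitEquiv_apply, labAt_encodeNat]

/-- **`PVld x (bin v)`** iff the final state of the digits is valid. [folklore] -/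
theorem pVld_iff (v : ℕ) : PVld F x (encodeNat v) ↔ (st F x (digits (gts F x).length v)).2.2 = true := by
  unfold PVld; rw [vldT_apply, stO_encodeNat]; simp

/-- **`labF`** on a numeral: the final label of the digits. [folklore] -/
theorem labF_eq (v : ℕ) : labF F (boolPair x (encodeNat v)) = List.ofFn (st F x (digits (gts F x).length v)).1 := by
  rw [labF_apply, stO_encodeNat]

/-- **`PAcc x (bin v)`** iff the final label of the digits accepts. [folklore] -/
theorem pAcc_iff (v : ℕ) : PAcc F x (encodeNat v) ↔ (st F x (digits (gts F x).length v)).1 ∈ QCircuit.acceptEvent _ := by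
  unfold PAcc; rw [accT_apply, stO_encodeNat, mem_acceptEvent_iff_headBit]; simp

/-- **`phkF k`** on a numeral: `1^{(φ + k) mod 8}` for the final phase of the digits. [folklore] -/
theorem phkF_eq (k v : ℕ) : phkF F k (boolPair x (encodeNat v)) = ones (((st F x (digits (gts F x).length v)).2.1 + k) % 8) := by
  rw [phkF_apply, stO_encodeNat]

/-- Phases of the total walk are reduced modulo `8` (from a reduced start). [folklore] -/
theorem tRunO_phase_lt {N : ℕ} (gs : List (QGate cliffordT N)) : ∀ (cs : List Bool) (s : TState N), s.2.1 < 8 → (tRunO gs cs s).2.1 < 8 := by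
  induction gs with
  | nil => intro cs s h; exact h
  | cons g gs ih =>
    intro cs s _
    apply ih
    obtain ⟨w, φ, v⟩ := s
    cases g with
    | oracle k e => exact Nat.mod_lt _ (by norm_num)
    | gate op e => cases op <;> simp [tStepO, tStep] <;> exact Nat.mod_lt _ (by norm_num)

/-- The final phase of `st` is `< 8`. [folklore] -/
theorem st_phase_lt (c : Fin (gts F x).length → Bool) : (st F x c).2.1 < 8 := tRunO_phase_lt _ _ _ (by norm_num)

end PathSem

/-! ### The counts -/

section Counts

variable (F : QCircuitFamily cliffordT) (x : List Bool)

/-- Counting the `t < n ≤ B` with a property among `t < 2^B`. [folklore] -/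
theorem card_filter_range_lt {B n : ℕ} (hn : n ≤ B) (P : ℕ → Prop) [DecidablePred P] :
    ((range (2 ^ B)).filter fun t => t < n ∧ P t).card = ((range n).filter P).card := by
  congr 1
  ext t
  simp only [Finset.mem_filter, Finset.mem_range]
  constructor
  · rintro ⟨-, ht, hp⟩; exact ⟨ht, hp⟩
  · rintro ⟨ht, hp⟩; exact ⟨ht.trans_le (hn.trans Nat.lt_two_pow_self.le), ht, hp⟩

variable {R : List Bool} (hx : xR R = x) (hd : dR R = F.descFn x)
include hx hd

omit hx in
/-- The number of gates is below `|R|`. [folklore] -/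
theorem mu_le_length : (gts F x).length ≤ (dR R).length ∧ (dR R).length ≤ R.length :=
  ⟨hd ▸ length_gates_le_length_descFn F x, (length_dR_le R).1⟩

/-- **`NGates R = μ`.** [folklore] -/
theorem nGates_eq : NGates F R = (gts F x).length := by
  obtain ⟨h1, h2⟩ := mu_le_length F x hd
  unfold NGates
  rw [eval_X, card_filter_range_lt h2]
  simp_rw [hx, pLive_iff]
  rw [show ((range (dR R).length).filter fun t => t < (gts F x).length) = range (gts F x).length by
    ext t; simp only [Finset.mem_filter, Finset.mem_range]; constructor
    · exact fun h => h.2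
    · exact fun h => ⟨h.trans_le h1, h⟩]
  exact Finset.card_range _

omit hx hd in
/-- Counting the positions of a list whose entry has a property. [folklore] -/
theorem card_filter_range_getElem {α : Type*} (P : α → Bool) (l : List α) :
    ((range l.length).filter fun t => ∃ h : t < l.length, P l[t] = true).card = l.countP P := by
  induction l using List.reverseRecOn with
  | nil => simp
  | append_singleton l a ih =>
    have hr : Finset.range (l ++ [a]).length = insert l.length (Finset.range l.length) := by
      rw [List.length_append, List.length_singleton, Finset.range_add_one]
    rw [List.countP_append, hr, Finset.filter_insert]
    have hcongr : ((range l.length).filter fun t => ∃ h : t < (l ++ [a]).length, P (l ++ [a])[t] = true) =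
        (range l.length).filter fun t => ∃ h : t < l.length, P l[t] = true := by
      refine Finset.filter_congr fun t ht => ?_
      rw [Finset.mem_range] at ht
      constructor
      · rintro ⟨h₁, h₂⟩; rw [List.getElem_append_left ht] at h₂; exact ⟨ht, h₂⟩
      · rintro ⟨h₁, h₂⟩; exact ⟨by simp; omega, by rw [List.getElem_append_left ht]; exact h₂⟩
    have hlast : (∃ h : l.length < (l ++ [a]).length, P (l ++ [a])[l.length] = true) ↔ P a = true := by
      constructor
      · rintro ⟨h₁, h₂⟩; simpa using h₂
      · intro h; exact ⟨by simp, by simpa using h⟩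
    by_cases ha : P a = true
    · rw [if_pos (hlast.2 ha), Finset.card_insert_of_notMem (by simp), hcongr, ih]
      simp [ha]
    · rw [if_neg (fun h => ha (hlast.1 h)), hcongr, ih]
      simp [ha]

/-- **`NHad R = h`**, the number of Hadamard gates. [folklore] -/
theorem nHad_eq : NHad F R = hCount (gts F x) := by
  obtain ⟨h1, h2⟩ := mu_le_length F x hd
  unfold NHad
  rw [eval_X, card_filter_range_lt h2]
  simp_rw [hx, pHad_iff]
  rw [show ((range (dR R).length).filter fun t => ∃ ht : t < (gts F x).length, QGateIsH (gts F x)[t] = true) =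
      (range (gts F x).length).filter fun t => ∃ ht : t < (gts F x).length, QGateIsH (gts F x)[t] = true by
    ext t; simp only [Finset.mem_filter, Finset.mem_range]
    constructor
    · rintro ⟨-, ht, h⟩; exact ⟨ht, ht, h⟩
    · rintro ⟨ht, ht', h⟩; exact ⟨ht.trans_le h1, ht', h⟩]
  rw [card_filter_range_getElem]
  rfl

/-- **`NOrc R`** is the number of oracle gates. [folklore] -/
theorem nOrc_eq : NOrc F R = (gts F x).countP isOracleB := by
  obtain ⟨h1, h2⟩ := mu_le_length F x hd
  unfold NOrc
  rw [eval_X, card_filter_range_lt h2]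
  simp_rw [hx, pRead_iff]
  rw [show ((range (dR R).length).filter fun t => ∃ (ht : t < (gts F x).length) (k : ℕ) (e : _), (gts F x)[t] = .oracle k e) =
      (range (gts F x).length).filter fun t => ∃ ht : t < (gts F x).length, isOracleB (gts F x)[t] = true by
    ext t; simp only [Finset.mem_filter, Finset.mem_range]
    constructor
    · rintro ⟨-, ht, k, e, h⟩; exact ⟨ht, ht, by rw [h]; rfl⟩
    · rintro ⟨ht, ht', h⟩
      refine ⟨ht.trans_le h1, ht', ?_⟩
      cases hg : (gts F x)[t] with
      | gate op e => rw [hg] at h; exact absurd h (by simp [isOracleB])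
      | oracle k e => exact ⟨k, e, rfl⟩]
  exact card_filter_range_getElem _ _

omit hx hd in
/-- The number of oracle gates is `oracleQueries`. [folklore] -/
theorem countP_isOracleB_eq : (gts F x).countP isOracleB = (F.circ x.length).oracleQueries := by
  unfold QCircuit.oracleQueries
  rw [List.countP_eq_length_filter]
  congr 1
  refine List.filter_congr fun g _ => ?_
  cases g <;> simp [isOracleB, QGate.IsOracleFree]

end Counts

/-! ### Guards and sign conditions -/

section SignSem

variable (F : QCircuitFamily cliffordT) (x : List Bool)

/-- `1^a = 1^b ↔ a = b` (a twin of the unrelated `CNFIsing.ones_eq_ones_iff`, not importable here). [folklore] -/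
private theorem ones_eq_ones_iff (a b : ℕ) : ones a = ones b ↔ a = b :=
  ⟨fun h => by simpa [ones] using congrArg List.length h, fun h => by rw [h]⟩

/-- **`Guard`** on a record reading `x`, `descFn x` and coin numerals: every coin is `< 2^μ`. [folklore] -/
theorem guard_iff {R : List Bool} (hx : xR R = x) (hd : dR R = F.descFn x) {v : ℕ → ℕ} (hc : ∀ s < 4, coinR s R = encodeNat (v s)) :
    Guard F R ↔ ∀ s < 4, v s < 2 ^ (gts F x).length := by
  unfold Guard
  rw [nGates_eq F x hx hd]
  simp only [List.mem_cons, List.not_mem_nil, or_false, forall_eq_or_imp, forall_eq]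
  rw [hc 0 (by norm_num), hc 1 (by norm_num), hc 2 (by norm_num), hc 3 (by norm_num)]
  simp only [bitsToNat_encodeNat]
  constructor
  · rintro ⟨h0, h1, h2, h3⟩ s hs
    interval_cases s <;> assumption
  · intro h; exact ⟨h 0 (by norm_num), h 1 (by norm_num), h 2 (by norm_num), h 3 (by norm_num)⟩

variable {R : List Bool} (hx : xR R = x) {s₀ s₁ : ℕ} {u u' : ℕ} (h₀ : coinR s₀ R = encodeNat u) (h₁ : coinR s₁ R = encodeNat u')
include hx h₀ h₁

/-- **`Meet`** on coin numerals: both final states of the digit functions valid, same label, accepting. [folklore] -/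
theorem meet_iff :
    Meet F s₀ s₁ R ↔ (st F x (digits (gts F x).length u)).2.2 = true ∧ (st F x (digits (gts F x).length u')).2.2 = true ∧
      (st F x (digits (gts F x).length u)).1 = (st F x (digits (gts F x).length u')).1 ∧
      (st F x (digits (gts F x).length u)).1 ∈ QCircuit.acceptEvent _ := by
  unfold Meet
  rw [hx, h₀, h₁, pVld_iff, pVld_iff, labF_eq, labF_eq, pAcc_iff]
  simp only [List.ofFn_inj]

/-- **`PhEq k`** on coin numerals: `φ = (φ' + k) mod 8`. [folklore] -/
theorem phEq_iff (k : ℕ) :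
    PhEq F k s₀ s₁ R ↔ (st F x (digits (gts F x).length u)).2.1 = ((st F x (digits (gts F x).length u')).2.1 + k) % 8 := by
  unfold PhEq
  rw [hx, h₀, h₁, phkF_eq, phkF_eq, ones_eq_ones_iff, Nat.add_zero, Nat.mod_eq_of_lt (st_phase_lt F x _)]

omit hx h₀ h₁ in
/-- Phase-difference classes versus shifted phases, for reduced phases. [folklore] -/
theorem class_eq_iff {φ φ' : ℕ} (hφ : φ < 8) (_hφ' : φ' < 8) (k : ℕ) (hk : k < 8) :
    (φ + 7 * φ') % 8 = k ↔ φ = (φ' + k) % 8 := by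
  omega

omit hx h₀ h₁ in
/-- The values of `reA`. [folklore] -/
theorem reA_eq_iff {d : ℕ} (hd : d < 8) : (reA d = 1 ↔ d = 0) ∧ (reA d = -1 ↔ d = 4) := by
  interval_cases d <;> simp [reA]

omit hx h₀ h₁ in
/-- The values of `reB`. [folklore] -/
theorem reB_eq_iff {d : ℕ} (hd : d < 8) : (reB d = 1 ↔ d = 1 ∨ d = 7) ∧ (reB d = -1 ↔ d = 3 ∨ d = 5) := by
  interval_cases d <;> simp [reB]

/-- **`TPos`/`TNeg` hold iff the pair term is `+1`/`−1`.** [cite: AdlemanDeMarraisHuang1997, §6 Lemma 6.10] -/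
theorem tPos_tNeg_iff (isB : Bool) :
    (TPos F isB s₀ s₁ R ↔ (if isB then tB F x else tA F x) (digits (gts F x).length u) (digits (gts F x).length u') = 1) ∧
    (TNeg F isB s₀ s₁ R ↔ (if isB then tB F x else tA F x) (digits (gts F x).length u) (digits (gts F x).length u') = -1) := by
  have hφ := st_phase_lt F x (digits (gts F x).length u)
  have hφ' := st_phase_lt F x (digits (gts F x).length u')
  have hmeet := meet_iff F x hx h₀ h₁
  have hph := fun k => phEq_iff F x hx h₀ h₁ k
  have hd : ((st F x (digits (gts F x).length u)).2.1 + 7 * (st F x (digits (gts F x).length u')).2.1) % 8 < 8 :=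
    Nat.mod_lt _ (by norm_num)
  unfold TPos TNeg
  cases isB
  · simp only [Bool.false_eq_true, ↓reduceIte, tA, pairTermA]
    rw [hmeet, hph 0, hph 4]
    constructor
    · split_ifs with hc
      · rw [(reA_eq_iff hd).1, class_eq_iff hφ hφ' 0 (by norm_num)]
        exact ⟨fun h => h.2, fun h => ⟨hc, h⟩⟩
      · constructor
        · rintro ⟨h, -⟩; exact absurd h hc
        · intro h; exact absurd h (by norm_num)
    · split_ifs with hc
      · rw [(reA_eq_iff hd).2, class_eq_iff hφ hφ' 4 (by norm_num)]
        exact ⟨fun h => h.2, fun h => ⟨hc, h⟩⟩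
      · constructor
        · rintro ⟨h, -⟩; exact absurd h hc
        · intro h; exact absurd h (by norm_num)
  · simp only [↓reduceIte, tB, pairTermB]
    rw [hmeet, hph 1, hph 7, hph 3, hph 5]
    constructor
    · split_ifs with hc
      · rw [(reB_eq_iff hd).1, class_eq_iff hφ hφ' 1 (by norm_num), class_eq_iff hφ hφ' 7 (by norm_num)]
        exact ⟨fun h => h.2, fun h => ⟨hc, h⟩⟩
      · constructor
        · rintro ⟨h, -⟩; exact absurd h hc
        · intro h; exact absurd h (by norm_num)
    · split_ifs with hc
      · rw [(reB_eq_iff hd).2, class_eq_iff hφ hφ' 3 (by norm_num), class_eq_iff hφ hφ' 5 (by norm_num)]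
        exact ⟨fun h => h.2, fun h => ⟨hc, h⟩⟩
      · constructor
        · rintro ⟨h, -⟩; exact absurd h hc
        · intro h; exact absurd h (by norm_num)

end SignSem

/-! ### The sign of the term of a record -/

section TermSem

variable (F : QCircuitFamily cliffordT) (x : List Bool)

/-- The pair weight named by a letter. [folklore] -/
def letter (isB : Bool) : (Fin (gts F x).length → Bool) → (Fin (gts F x).length → Bool) → ℤ := if isB then tB F x else tA F x

/-- **The term of kind `κ`** at a quadruple of coin functions: `t_X(c₀,c₁)` (pair) or
`t_X(c₀,c₁) · t_Y(c₂,c₃)` (quadruple). [cite: AaronsonAmbainis2014, proof of Thm. 23 (p. 14)] -/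
def termVal (κ : Kind) (c : Fin 4 → (Fin (gts F x).length → Bool)) : ℤ :=
  if κ.quad then letter F x κ.bX (c 0) (c 1) * letter F x κ.bY (c 2) (c 3) else letter F x κ.bX (c 0) (c 1)

/-- Pair weights are in `{−1, 0, 1}`. [folklore] -/
theorem letter_mem (isB : Bool) (c c' : Fin (gts F x).length → Bool) :
    letter F x isB c c' = 0 ∨ letter F x isB c c' = 1 ∨ letter F x isB c c' = -1 := by
  unfold letter tA tB pairTermA pairTermB
  have h8 : ((st F x c).2.1 + 7 * (st F x c').2.1) % 8 < 8 := Nat.mod_lt _ (by norm_num)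
  cases isB <;> simp only [Bool.false_eq_true, ↓reduceIte] <;> split_ifs
  · generalize ((st F x c).2.1 + 7 * (st F x c').2.1) % 8 = d at h8; interval_cases d <;> simp [reA]
  · simp
  · generalize ((st F x c).2.1 + 7 * (st F x c').2.1) % 8 = d at h8; interval_cases d <;> simp [reB]
  · simp

/-- **`TSign κ pos`** on a record with coin numerals holds iff the term of the digit functions is
`+1` (`pos`) resp. `−1`. [cite: AaronsonAmbainis2014, proof of Thm. 23 (p. 14)] -/
theorem tSign_iff {R : List Bool} (hx : xR R = x) {v : ℕ → ℕ} (hc : ∀ s < 4, coinR s R = encodeNat (v s)) (κ : Kind) (pos : Bool) :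
    TSign F κ pos R ↔ termVal F x κ (fun s => digits (gts F x).length (v s)) = if pos then 1 else -1 := by
  obtain ⟨hp01, hn01⟩ := tPos_tNeg_iff F x hx (hc 0 (by norm_num)) (hc 1 (by norm_num)) κ.bX
  obtain ⟨hp23, hn23⟩ := tPos_tNeg_iff F x hx (hc 2 (by norm_num)) (hc 3 (by norm_num)) κ.bY
  have hl01 := letter_mem F x κ.bX (digits (gts F x).length (v 0)) (digits (gts F x).length (v 1))
  have hl23 := letter_mem F x κ.bY (digits (gts F x).length (v 2)) (digits (gts F x).length (v 3))
  unfold TSign termVal letter at *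
  obtain ⟨q, bX, bY, fl⟩ := κ
  simp only at *
  cases q <;> cases pos <;> simp only [Bool.false_eq_true, ↓reduceIte]
  · exact hn01
  · exact hp01
  · rw [hp01, hn01, hp23, hn23]
    rcases hl01 with h | h | h <;> rcases hl23 with h' | h' | h' <;> simp [h, h']
  · rw [hp01, hn01, hp23, hn23]
    rcases hl01 with h | h | h <;> rcases hl23 with h' | h' | h' <;> simp [h, h']

end TermSem

end Thm23Machine

end Literature.Computability.QuantumComplexity

end
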